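import Literature.NumberTheory.ZetaValues.AperyLikeGeneratingFunctions
import HarnessLib

/-!
# The coefficientwise WZ pair behind the Koecher–Leshchiner series for all odd zeta values

Topic `Literature/NumberTheory/ZetaValues`. [Tauraso2025, §1 (display after (KL))] (tree: `koecherLeshchiner_oddZeta`)
states, for every `r ≥ 0`, `ζ(2r+3) = Σ_{k≥1} ((−1)^{k−1−r}/(k³C(2k,k))) ((5/2)H_{k−1}({2}^r) + 2Σ_{j=1}^{r}((−1)^j/k^{2j})H_{k−1}({2}^{r−j}))`,
the coefficient of `a^{2r}` in Koecher's generating function [Koecher1980] (tree THEOREM `koecher_generatingFunction`).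
Instead of extracting Taylor coefficients analytically, this file takes the `a^{2r}`-COEFFICIENTS of the WZ pair of
[HessamiPilehrood2008WZ, §2] for Koecher's identity (as `KoecherZetaFiveProofs.lean` did for `r = 1`): writing
`∏_{m≤n}(1 − u/m²) = Σ_i (−u)^i e_i(n)` with `e_i(n) = H_n({2}^i) = multipleHarmonicTwo n i`, `c(n,k) = k!n!²/(2n+k+1)!`,
`D = (n+k+1)²`, `Q = 5(n+1)² + k² + 4k(n+1)`, the coefficient pair is
`F_r(n,k) = (−1)ⁿ c Σ_{i≤r} (−1)^i e_i(n) D^{−(r−i+1)}`,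
`G_r(n,k) = (−1)ⁿ c/((2n+k+2)(2n+2)) ((−1)^r e_r(n) + (Q−D) Σ_{i≤r} (−1)^i e_i(n) D^{−(r−i+1)})`.
PROVED here: the recursion `e_{i+1}(n+1) = e_{i+1}(n) + e_i(n)/(n+1)²` (`multipleHarmonicTwo_succ_succ`), the WZ relation
`F_r(n+1,k) − F_r(n,k) = G_r(n,k+1) − G_r(n,k)` for every `r` (`kl_wz` — after the recursion and one re-indexing it is linear
in the two sums and `e_r(n)`, with coefficient identities `σ₀(Q−D) = 1`, `ρ((n+k+2)²−(n+1)²)/(n+1)² = σ₁(Q₁−D₂)`,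
`σ₁ − σ₀ + ρ/(n+1)² = 0`), `F_r(0,k) = (k+1)^{−(2r+3)}` (`kl_F_zero`) and `G_r(n,0)` = the `k = n+1` summand of (KL)
(`kl_G_zero`). The summation is in `KoecherLeshchinerProofs.lean`. No definitions (`let`-bound lambdas).
-/

open Finset

noncomputable section

namespace Literature.NumberTheory.ZetaValues

/-- `H_n({2}^0) = 1` (the empty product). [cite: Tauraso2025, §1 (definition of H_k({2}^s))] -/
theorem multipleHarmonicTwo_zero (n : ℕ) : multipleHarmonicTwo n 0 = 1 := by
  simp [multipleHarmonicTwo, Finset.powersetCard_zero]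

/-- The recursion of the elementary symmetric sums: `H_{n+1}({2}^{i+1}) = H_n({2}^{i+1}) + H_n({2}^i)/(n+1)²`.
[cite: Tauraso2025, §1 (definition of H_k({2}^s))] -/
theorem multipleHarmonicTwo_succ_succ (n i : ℕ) :
    multipleHarmonicTwo (n + 1) (i + 1) = multipleHarmonicTwo n (i + 1) + multipleHarmonicTwo n i / ((n : ℝ) + 1) ^ 2 := by
  unfold multipleHarmonicTwo
  have hnot : n + 1 ∉ Icc 1 n := by simp
  rw [← Finset.insert_Icc_right_eq_Icc_add_one (by omega : 1 ≤ n + 1), Finset.powersetCard_succ_insert hnot,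
    Finset.sum_union]
  · congr 1
    rw [Finset.sum_image]
    · rw [Finset.sum_div]
      refine sum_congr rfl fun S hS => ?_
      have hS' : S ⊆ Icc 1 n := (Finset.mem_powersetCard.1 hS).1
      have hnS : n + 1 ∉ S := fun h => hnot (hS' h)
      rw [Finset.prod_insert hnS]
      push_cast
      ring
    · intro S hS T hT hST
      have hnS : n + 1 ∉ S := fun h => hnot ((Finset.mem_powersetCard.1 (Finset.mem_coe.1 hS)).1 h)
      have hnT : n + 1 ∉ T := fun h => hnot ((Finset.mem_powersetCard.1 (Finset.mem_coe.1 hT)).1 h)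
      rw [← Finset.erase_insert hnS, ← Finset.erase_insert hnT, hST]
  · rw [Finset.disjoint_left]
    intro S hS hS'
    obtain ⟨T, hT, rfl⟩ := Finset.mem_image.1 hS'
    exact hnot ((Finset.mem_powersetCard.1 hS).1 (Finset.mem_insert_self _ _))

/-- The hypergeometric factor under `n ↦ n+1` (as in `KoecherZetaFiveProofs.lean`). [folklore] -/
private theorem hyp_succ_n' (n k : ℕ) :
    ((k.factorial : ℝ) * ((n + 1).factorial : ℝ) ^ 2 / ((2 * (n + 1) + k + 1).factorial : ℝ)) =
      ((k.factorial : ℝ) * (n.factorial : ℝ) ^ 2 / ((2 * n + k + 1).factorial : ℝ)) * (((n : ℝ) + 1) ^ 2 / ((2 * (n : ℝ) + k + 2) * (2 * (n : ℝ) + k + 3))) := by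
  have e1 : ((2 * (n + 1) + k + 1).factorial : ℝ) = (2 * (n : ℝ) + k + 3) * (2 * (n : ℝ) + k + 2) *
      ((2 * n + k + 1).factorial : ℝ) := by
    rw [show 2 * (n + 1) + k + 1 = (2 * n + k + 1) + 1 + 1 by ring, Nat.factorial_succ, Nat.factorial_succ]; push_cast; ring
  have e2 : ((n + 1).factorial : ℝ) = ((n : ℝ) + 1) * (n.factorial : ℝ) := by rw [Nat.factorial_succ]; push_cast; ring
  have h1 : ((2 * n + k + 1).factorial : ℝ) ≠ 0 := by positivity
  rw [e1, e2]
  field_simp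

/-- The hypergeometric factor under `k ↦ k+1`. [folklore] -/
private theorem hyp_succ_k' (n k : ℕ) :
    (((k + 1).factorial : ℝ) * (n.factorial : ℝ) ^ 2 / ((2 * n + (k + 1) + 1).factorial : ℝ)) =
      ((k.factorial : ℝ) * (n.factorial : ℝ) ^ 2 / ((2 * n + k + 1).factorial : ℝ)) * (((k : ℝ) + 1) / (2 * (n : ℝ) + k + 2)) := by
  have e1 : ((2 * n + (k + 1) + 1).factorial : ℝ) = (2 * (n : ℝ) + k + 2) * ((2 * n + k + 1).factorial : ℝ) := by
    rw [show 2 * n + (k + 1) + 1 = (2 * n + k + 1) + 1 by ring, Nat.factorial_succ]; push_cast; ring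
  have e2 : ((k + 1).factorial : ℝ) = ((k : ℝ) + 1) * (k.factorial : ℝ) := by rw [Nat.factorial_succ]; push_cast; ring
  have h1 : ((2 * n + k + 1).factorial : ℝ) ≠ 0 := by positivity
  rw [e1, e2]
  field_simp

/-- The shifted coefficient sum: `Σ_{i≤r} (−1)^i e_i(n+1) D₂^{−(r−i+1)} = T(1 − D₂/(n+1)²) + (−1)^r e_r(n)/(n+1)²` with
`T = Σ_{i≤r} (−1)^i e_i(n) D₂^{−(r−i+1)}`, from the recursion of the `e_i` and one re-indexing. [folklore] -/
private theorem shifted_sum (r n : ℕ) (D₂ : ℝ) (hD : D₂ ≠ 0) :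
    ∑ i ∈ range (r + 1), (-1 : ℝ) ^ i * multipleHarmonicTwo (n + 1) i / D₂ ^ (r - i + 1) =
      (∑ i ∈ range (r + 1), (-1 : ℝ) ^ i * multipleHarmonicTwo n i / D₂ ^ (r - i + 1)) * (1 - D₂ / ((n : ℝ) + 1) ^ 2) +
        (-1 : ℝ) ^ r * multipleHarmonicTwo n r / ((n : ℝ) + 1) ^ 2 := by
  set N2 : ℝ := ((n : ℝ) + 1) ^ 2 with hN2
  have hN : N2 ≠ 0 := by positivity
  set T := ∑ i ∈ range (r + 1), (-1 : ℝ) ^ i * multipleHarmonicTwo n i / D₂ ^ (r - i + 1) with hT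
  -- peel off `i = 0` and use the recursion
  have h1 : ∑ i ∈ range (r + 1), (-1 : ℝ) ^ i * multipleHarmonicTwo (n + 1) i / D₂ ^ (r - i + 1) =
      (∑ i ∈ range r, (-1 : ℝ) ^ (i + 1) * multipleHarmonicTwo n (i + 1) / D₂ ^ (r - (i + 1) + 1) +
        (-1 : ℝ) ^ 0 * multipleHarmonicTwo n 0 / D₂ ^ (r - 0 + 1)) +
      (1 / N2) * ∑ i ∈ range r, (-1 : ℝ) ^ (i + 1) * multipleHarmonicTwo n i / D₂ ^ (r - (i + 1) + 1) := by
    rw [sum_range_succ', multipleHarmonicTwo_zero, multipleHarmonicTwo_zero, mul_sum]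
    have e : ∑ i ∈ range r, (-1 : ℝ) ^ (i + 1) * multipleHarmonicTwo (n + 1) (i + 1) / D₂ ^ (r - (i + 1) + 1) =
        ∑ i ∈ range r, (-1 : ℝ) ^ (i + 1) * multipleHarmonicTwo n (i + 1) / D₂ ^ (r - (i + 1) + 1) +
          ∑ i ∈ range r, 1 / N2 * ((-1 : ℝ) ^ (i + 1) * multipleHarmonicTwo n i / D₂ ^ (r - (i + 1) + 1)) := by
      rw [← sum_add_distrib]
      refine sum_congr rfl fun i _ => ?_
      rw [multipleHarmonicTwo_succ_succ]
      field_simp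
      ring
    rw [e]; ring
  have h2 : ∑ i ∈ range r, (-1 : ℝ) ^ (i + 1) * multipleHarmonicTwo n (i + 1) / D₂ ^ (r - (i + 1) + 1) +
      (-1 : ℝ) ^ 0 * multipleHarmonicTwo n 0 / D₂ ^ (r - 0 + 1) = T := by
    rw [hT, sum_range_succ' (fun i => (-1 : ℝ) ^ i * multipleHarmonicTwo n i / D₂ ^ (r - i + 1))]
  -- re-index the second sum: for `i < r`, `D₂^{r−(i+1)+1} = D₂^{r−i}` and `1/D₂^{r−i} = D₂/D₂^{r−i+1}`
  have h3 : ∑ i ∈ range r, (-1 : ℝ) ^ (i + 1) * multipleHarmonicTwo n i / D₂ ^ (r - (i + 1) + 1) =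
      -D₂ * (T - (-1 : ℝ) ^ r * multipleHarmonicTwo n r / D₂) := by
    have e : T - (-1 : ℝ) ^ r * multipleHarmonicTwo n r / D₂ =
        ∑ i ∈ range r, (-1 : ℝ) ^ i * multipleHarmonicTwo n i / D₂ ^ (r - i + 1) := by
      rw [hT, sum_range_succ, Nat.sub_self, zero_add, pow_one]; ring
    rw [e, mul_sum]
    refine sum_congr rfl fun i hi => ?_
    have hir : i < r := mem_range.1 hi
    rw [show r - (i + 1) + 1 = r - i by omega, show r - i + 1 = (r - i) + 1 from rfl, pow_succ, pow_succ]
    field_simp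
  rw [h1, h2, h3]
  field_simp
  ring

/-- **The `a^{2r}`-coefficient WZ pair of Koecher's identity**: `F_r(n+1,k) − F_r(n,k) = G_r(n,k+1) − G_r(n,k)` for every
`r, n, k`. [cite: HessamiPilehrood2008WZ, §2 (the pair for Koecher's identity, read coefficientwise in a²)]
[cite: Koecher1980, (the generating function of ζ(2n+3))] -/
theorem kl_wz (r n k : ℕ) :
    let F : ℕ → ℕ → ℝ := fun n k =>
      (-1 : ℝ) ^ n * ((k.factorial : ℝ) * (n.factorial : ℝ) ^ 2 / ((2 * n + k + 1).factorial : ℝ)) *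
        (∑ i ∈ range (r + 1), (-1 : ℝ) ^ i * multipleHarmonicTwo n i / (((n : ℝ) + k + 1) ^ 2) ^ (r - i + 1))
    let G : ℕ → ℕ → ℝ := fun n k =>
      (-1 : ℝ) ^ n * ((k.factorial : ℝ) * (n.factorial : ℝ) ^ 2 / ((2 * n + k + 1).factorial : ℝ)) / ((2 * (n : ℝ) + k + 2) * (2 * (n : ℝ) + 2)) *
        ((-1 : ℝ) ^ r * multipleHarmonicTwo n r + ((5 * ((n : ℝ) + 1) ^ 2 + (k : ℝ) ^ 2 + 4 * (k : ℝ) * ((n : ℝ) + 1)) - (((n : ℝ) + k + 1) ^ 2)) *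
          (∑ i ∈ range (r + 1), (-1 : ℝ) ^ i * multipleHarmonicTwo n i / (((n : ℝ) + k + 1) ^ 2) ^ (r - i + 1)))
    F (n + 1) k - F n k = G n (k + 1) - G n k := by
  intro F G
  simp only [F, G]
  rw [hyp_succ_n', hyp_succ_k', pow_succ (-1 : ℝ) n]
  push_cast
  have hD2 : ((n : ℝ) + 1 + k + 1) ^ 2 ≠ 0 := by positivity
  rw [shifted_sum r n _ hD2]
  -- the identity is linear in the two sums `T` (denominator `D₂`) and `U` (denominator `D`) and in `e_r(n)`
  have eT : ∑ i ∈ range (r + 1), (-1 : ℝ) ^ i * multipleHarmonicTwo n i / (((n : ℝ) + ((k : ℝ) + 1) + 1) ^ 2) ^ (r - i + 1) =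
      ∑ i ∈ range (r + 1), (-1 : ℝ) ^ i * multipleHarmonicTwo n i / (((n : ℝ) + 1 + k + 1) ^ 2) ^ (r - i + 1) :=
    sum_congr rfl fun i _ => by ring_nf
  rw [eT]
  set T := ∑ i ∈ range (r + 1), (-1 : ℝ) ^ i * multipleHarmonicTwo n i / (((n : ℝ) + 1 + k + 1) ^ 2) ^ (r - i + 1)
  set U := ∑ i ∈ range (r + 1), (-1 : ℝ) ^ i * multipleHarmonicTwo n i / (((n : ℝ) + k + 1) ^ 2) ^ (r - i + 1)
  set E := (-1 : ℝ) ^ r * multipleHarmonicTwo n r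
  set c := ((k.factorial : ℝ) * (n.factorial : ℝ) ^ 2 / ((2 * n + k + 1).factorial : ℝ))
  set s := (-1 : ℝ) ^ n
  have h1 : (n : ℝ) + k + 1 ≠ 0 := by positivity
  have h3 : (n : ℝ) + 1 ≠ 0 := by positivity
  have h4 : 2 * (n : ℝ) + k + 2 ≠ 0 := by positivity
  have h5 : 2 * (n : ℝ) + k + 3 ≠ 0 := by positivity
  have h6 : 2 * (n : ℝ) + 2 ≠ 0 := by positivity
  have h7 : (n : ℝ) + 1 + k + 1 ≠ 0 := by positivity
  have h8 : 2 * (n : ℝ) + (k + 1) + 2 ≠ 0 := by positivity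
  field_simp
  ring

/-- `F_r(0,k) = (k+1)^{−(2r+3)}`: the general term of `ζ(2r+3)`. [cite: Tauraso2025, §1 (KL)] -/
theorem kl_F_zero (r k : ℕ) :
    let F : ℕ → ℕ → ℝ := fun n k =>
      (-1 : ℝ) ^ n * ((k.factorial : ℝ) * (n.factorial : ℝ) ^ 2 / ((2 * n + k + 1).factorial : ℝ)) *
        (∑ i ∈ range (r + 1), (-1 : ℝ) ^ i * multipleHarmonicTwo n i / (((n : ℝ) + k + 1) ^ 2) ^ (r - i + 1))
    F 0 k = 1 / ((k : ℝ) + 1) ^ (2 * r + 3) := by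
  intro F
  simp only [F]
  have hzero : ∀ i : ℕ, multipleHarmonicTwo 0 (i + 1) = 0 := fun i => by
    unfold multipleHarmonicTwo
    rw [show Finset.Icc 1 0 = ∅ by decide, Finset.powersetCard_eq_empty.2 (by simp)]
    simp
  rw [sum_range_succ', sum_eq_zero (fun i _ => by rw [hzero]; simp), zero_add,
    show 2 * 0 + k + 1 = k + 1 by ring, Nat.factorial_succ, multipleHarmonicTwo_zero]
  simp only [Nat.sub_zero, pow_zero, one_mul, Nat.factorial_zero, one_pow, mul_one, Nat.cast_zero,
    zero_add, Nat.cast_mul, Nat.cast_succ]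
  have hk : (k.factorial : ℝ) ≠ 0 := by positivity
  have hk1 : (k : ℝ) + 1 ≠ 0 := by positivity
  rw [← pow_mul, show ((k : ℝ) + 1) ^ (2 * r + 3) = ((k : ℝ) + 1) ^ (2 * (r + 1)) * ((k : ℝ) + 1) by ring]
  field_simp

/-- `C(2n+2, n+1) ((n+1) n!)² = (2n+2)(2n+1)!` in `ℝ`. [folklore] -/
private theorem centralBinom_succ_mul_sq' (n : ℕ) :
    (((n + 1).centralBinom : ℕ) : ℝ) * (((n : ℝ) + 1) * (n.factorial : ℝ)) ^ 2 =
      (2 * (n : ℝ) + 2) * ((2 * n + 1).factorial : ℝ) := by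
  have h := Nat.choose_mul_factorial_mul_factorial (show n + 1 ≤ 2 * (n + 1) by omega)
  rw [show 2 * (n + 1) - (n + 1) = n + 1 by omega, ← Nat.centralBinom_eq_two_mul_choose,
    show 2 * (n + 1) = (2 * n + 1) + 1 by ring, Nat.factorial_succ (2 * n + 1), Nat.factorial_succ n] at h
  have h' : (((n + 1).centralBinom : ℕ) : ℝ) * (((n : ℝ) + 1) * (n.factorial : ℝ)) * (((n : ℝ) + 1) * (n.factorial : ℝ)) =
      (2 * (n : ℝ) + 1 + 1) * ((2 * n + 1).factorial : ℝ) := by exact_mod_cast h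
  linear_combination h'

/-- Re-indexing `j = r − i` of the inner sum of ((-1 : ℝ) ^ (n + 2 + r) / (((n + 1 : ℕ) : ℝ) ^ 3 * ((n + 1).centralBinom : ℝ)) *
        (5 / 2 * multipleHarmonicTwo n r +
          2 * ∑ j ∈ Finset.Icc 1 r, (-1 : ℝ) ^ j / ((n + 1 : ℕ) : ℝ) ^ (2 * j) * multipleHarmonicTwo n (r - j))): `Σ_{j=1}^{r} (−1)^j e_{r−j}(n)/(n+1)^{2j} = (−1)^r Σ_{i<r} (−1)^i e_i(n)/((n+1)²)^{r−i}`.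
[folklore] -/
private theorem inner_sum_reindex (r n : ℕ) :
    ∑ j ∈ Finset.Icc 1 r, (-1 : ℝ) ^ j / ((n + 1 : ℕ) : ℝ) ^ (2 * j) * multipleHarmonicTwo n (r - j) =
      (-1 : ℝ) ^ r * ∑ i ∈ range r, (-1 : ℝ) ^ i * multipleHarmonicTwo n i / (((n : ℝ) + 1) ^ 2) ^ (r - i) := by
  rw [← Finset.Ico_add_one_right_eq_Icc, sum_Ico_eq_sum_range, Nat.add_sub_cancel, mul_sum,
    ← sum_range_reflect]
  refine sum_congr rfl fun l hl => ?_
  have hlr : l < r := mem_range.1 hl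
  have e1 : 1 + (r - 1 - l) = r - l := by omega
  have e2 : r - (r - l) = l := by omega
  rw [e1, e2]
  have hsign : (-1 : ℝ) ^ (r - l) = (-1 : ℝ) ^ r * (-1 : ℝ) ^ l := by
    have h1 : (-1 : ℝ) ^ (r - l) * (-1 : ℝ) ^ l = (-1 : ℝ) ^ r := by rw [← pow_add, Nat.sub_add_cancel hlr.le]
    have h2 : (-1 : ℝ) ^ l * (-1 : ℝ) ^ l = 1 := by rw [← pow_add, ← two_mul, pow_mul]; norm_num
    calc (-1 : ℝ) ^ (r - l) = (-1 : ℝ) ^ (r - l) * ((-1 : ℝ) ^ l * (-1 : ℝ) ^ l) := by rw [h2, mul_one]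
      _ = (-1 : ℝ) ^ r * (-1 : ℝ) ^ l := by rw [← mul_assoc, h1]
  rw [hsign, pow_mul]
  push_cast
  ring

/-- `G_r(n,0)` is the `k = n+1` summand of ((-1 : ℝ) ^ (n + 2 + r) / (((n + 1 : ℕ) : ℝ) ^ 3 * ((n + 1).centralBinom : ℝ)) *
        (5 / 2 * multipleHarmonicTwo n r +
          2 * ∑ j ∈ Finset.Icc 1 r, (-1 : ℝ) ^ j / ((n + 1 : ℕ) : ℝ) ^ (2 * j) * multipleHarmonicTwo n (r - j))), LITERALLY as typed in `koecherLeshchiner_oddZeta`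
(`n!²/((2n+1)!(2n+2)²) = 1/(2(n+1)³C(2n+2,n+1))`, `(Q−D)|_{k=0} = 4(n+1)²`, the inner sum re-indexed by `j = r − i`).
[cite: Tauraso2025, §1 (display after ((-1 : ℝ) ^ (n + 2 + r) / (((n + 1 : ℕ) : ℝ) ^ 3 * ((n + 1).centralBinom : ℝ)) *
        (5 / 2 * multipleHarmonicTwo n r +
          2 * ∑ j ∈ Finset.Icc 1 r, (-1 : ℝ) ^ j / ((n + 1 : ℕ) : ℝ) ^ (2 * j) * multipleHarmonicTwo n (r - j))))] -/
theorem kl_G_zero (r n : ℕ) :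
    let G : ℕ → ℕ → ℝ := fun n k =>
      (-1 : ℝ) ^ n * ((k.factorial : ℝ) * (n.factorial : ℝ) ^ 2 / ((2 * n + k + 1).factorial : ℝ)) / ((2 * (n : ℝ) + k + 2) * (2 * (n : ℝ) + 2)) *
        ((-1 : ℝ) ^ r * multipleHarmonicTwo n r + ((5 * ((n : ℝ) + 1) ^ 2 + (k : ℝ) ^ 2 + 4 * (k : ℝ) * ((n : ℝ) + 1)) - (((n : ℝ) + k + 1) ^ 2)) *
          (∑ i ∈ range (r + 1), (-1 : ℝ) ^ i * multipleHarmonicTwo n i / (((n : ℝ) + k + 1) ^ 2) ^ (r - i + 1)))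
    G n 0 = (-1 : ℝ) ^ (n + 2 + r) / (((n + 1 : ℕ) : ℝ) ^ 3 * ((n + 1).centralBinom : ℝ)) *
        (5 / 2 * multipleHarmonicTwo n r +
          2 * ∑ j ∈ Finset.Icc 1 r, (-1 : ℝ) ^ j / ((n + 1 : ℕ) : ℝ) ^ (2 * j) * multipleHarmonicTwo n (r - j)) := by
  intro G
  simp only [G]
  rw [inner_sum_reindex]
  -- the `i = r` term of the coefficient sum, and `1/N2^{r−i+1} = (1/N2)(1/N2^{r−i})` on the rest
  have eS : ∑ i ∈ range (r + 1), (-1 : ℝ) ^ i * multipleHarmonicTwo n i / ((((n : ℝ) + ((0 : ℕ) : ℝ) + 1) ^ 2)) ^ (r - i + 1) =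
      (∑ i ∈ range r, (-1 : ℝ) ^ i * multipleHarmonicTwo n i / (((n : ℝ) + 1) ^ 2) ^ (r - i)) / ((n : ℝ) + 1) ^ 2 +
        (-1 : ℝ) ^ r * multipleHarmonicTwo n r / ((n : ℝ) + 1) ^ 2 := by
    rw [sum_range_succ, Nat.sub_self, zero_add, pow_one, Nat.cast_zero, add_zero, sum_div]
    congr 1
    refine sum_congr rfl fun i _ => ?_
    rw [pow_succ, div_div]
  rw [eS]
  -- `(−1)^{n+2+r} = (−1)^n (−1)^r` and `((−1)^r)² = 1`
  have ht2 : (-1 : ℝ) ^ r * (-1 : ℝ) ^ r = 1 := by rw [← pow_add, ← two_mul, pow_mul]; norm_num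
  set W := ∑ i ∈ range r, (-1 : ℝ) ^ i * multipleHarmonicTwo n i / (((n : ℝ) + 1) ^ 2) ^ (r - i)
  set E := multipleHarmonicTwo n r
  have key : (-1 : ℝ) ^ (n + 2 + r) / (((n + 1 : ℕ) : ℝ) ^ 3 * ((n + 1).centralBinom : ℝ)) *
      (5 / 2 * E + 2 * ((-1 : ℝ) ^ r * W)) =
      (-1 : ℝ) ^ n / (((n + 1 : ℕ) : ℝ) ^ 3 * ((n + 1).centralBinom : ℝ)) * (5 / 2 * (-1 : ℝ) ^ r * E + 2 * W) := by
    rw [show (-1 : ℝ) ^ (n + 2 + r) = (-1 : ℝ) ^ n * (-1 : ℝ) ^ r by rw [pow_add, pow_add]; norm_num]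
    linear_combination ((-1 : ℝ) ^ n / (((n + 1 : ℕ) : ℝ) ^ 3 * ((n + 1).centralBinom : ℝ)) * 2 * W) * ht2
  rw [key]
  have hC : (((n + 1).centralBinom : ℕ) : ℝ) ≠ 0 := by exact_mod_cast (Nat.centralBinom_pos (n + 1)).ne'
  have hnf : (n.factorial : ℝ) ≠ 0 := by positivity
  have hf2 : ((2 * n + 1).factorial : ℝ) ≠ 0 := by positivity
  have hn1 : ((n : ℝ) + 1) ≠ 0 := by positivity
  have h22 : (2 * (n : ℝ) + 2) ≠ 0 := by positivity
  have eC : (((n + 1).centralBinom : ℕ) : ℝ) =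
      (2 * (n : ℝ) + 2) * ((2 * n + 1).factorial : ℝ) / (((n : ℝ) + 1) * (n.factorial : ℝ)) ^ 2 := by
    rw [eq_div_iff (pow_ne_zero _ (mul_ne_zero hn1 hnf))]; exact centralBinom_succ_mul_sq' n
  set t := (-1 : ℝ) ^ r
  set s := (-1 : ℝ) ^ n
  simp only [Nat.cast_zero, add_zero, mul_zero, zero_pow two_ne_zero, Nat.factorial_zero, Nat.cast_one, one_mul]
  push_cast
  rw [eC]
  field_simp
  ring

end Literature.NumberTheory.ZetaValues
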